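import Mathlib.Analysis.InnerProductSpace.Projection.Reflection
import Literature.MathematicalPhysics.StatisticalMechanics.HcpSiteGeometry
import Literature.MathematicalPhysics.StatisticalMechanics.HcpHomogeneous
import Summits.AtomisticToContinuum.Crystallization.Theorems.HullExactificationCascadeExactHcpLocalTheoremRigidity

/-!
# `StackingHinge` (stmt-AtomisticToContinuum-14993), line `Sketch`: stub `stub_hcpContinuationUnique`

Crux `Summit.AtomisticToContinuum.Crystallization.Theses.PricedLinkCensus.StackingHinge`, line
`Sketch`, stub `stub_hcpContinuationUnique` (UNIQUENESS OF CONTINUATION for the discrete-Liouville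
endgame): on the certified parameter box `189/200 ≤ a ≤ 199/200`, `77/100 ≤ h ≤ 163/200`, if two
linear isometry equivalences `A, B` of `ℝ³` are such that `A` maps every site of the relaxed hcp
net `hcpStacking a h` of norm `≤ 6/5` into `B '' hcpStacking a h`, then
`A '' hcpStacking a h = B '' hcpStacking a h` (a rotated copy of the net is determined by its first
shell).

Proof.  Put `g = B⁻¹ ∘ A`; then `g z ∈ net` for every site `z` with `‖z‖ ≤ 6/5`, in particular for
the first-shell sites `±u`, `±v` (norm `a`) and `w + h e₃` (norm `√(a²/3 + h²)`), all of norm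
`≤ 6/5` on the box.  We show that `g` preserves the net (`g x ∈ net ↔ x ∈ net`), whence
`A '' net = B '' (g '' net) = B '' net`.

* **Antipodes.**  `g u` is a site of squared norm `a²` whose antipode `g (−u) = −g u` is again a
  site; a site with an antipodal site lies in an even layer (`even_of_neg_site_mem`: the cap
  sites `w' ± h e₃` have no antipodes), and an even layer `k ≠ 0` has height² `≥ 4h² > a²` on the
  box, so `g u` is one of the six hexagon sites `(0, i, j)`, `i² + ij + j² = 1`; likewise `g v`.
* **Normalisation.**  The stabiliser of the net is transitive on the hexagon
  (`exists_sym_apply_u`), so after composing with a symmetry of the net we may assume `g u = u`.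
  Then `⟪u, g v⟫ = ⟪u, v⟫ = a²/2` leaves `g v ∈ {v, u − v}`.
* If `g v = v`, an isometry fixing `u, v` is the identity or the horizontal mirror `σ_h`
  (`eq_refl_or_mirrorH`), both of which preserve the net (`mirrorH_mem_iff`).
* If `g v = u − v`, the site `g (w + h e₃) = (k', i', j')` would satisfy
  `⟪u, ·⟫ = ⟪u − v, ·⟫ = a²/2`, i.e. `2i' + j' + L = 1` and `i' − j' = 1` with the letter
  `L ∈ {0, 1}`, so `3 i' = 2 − L`: impossible.

Uses the in-tree hcp frame/mirror API of `HullExactificationCascadeExactHcpLocalTheorem{Shell,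
Frame,Rigidity}` (namespace `ExactHcpLocal`; those lemmas carry no box hypothesis).  All
`[folklore]` (the point stabiliser of hcp is `D_{3h}`; Conway–Sloane, *SPLAG*, Ch. 1 §1.3).
-/

noncomputable section

namespace Summit.AtomisticToContinuum.Crystallization.Theorems.PricedHcpWindowsHcpContinuation

open Literature.MathematicalPhysics.StatisticalMechanics
open Literature.Geometry.DiscreteGeometry
open Summit.AtomisticToContinuum.Crystallization.Theorems.ExactHcpLocal
open RealInnerProductSpace

variable {a h : ℝ}

/-! ## The parameter box -/

/-- **Envelope of the box** `189/200 ≤ a ≤ 199/200`, `77/100 ≤ h ≤ 163/200`: `0 < a`, `0 < h`,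
`a² < 4h²` (an even layer `k ≠ 0` is higher than `a`), and the first-shell norms are `≤ 6/5`:
`a² ≤ (6/5)²`, `a²/3 + h² ≤ (6/5)²`. [folklore] -/
theorem box_facts (ha₁ : 189 / 200 ≤ a) (ha₂ : a ≤ 199 / 200) (hh₁ : 77 / 100 ≤ h)
    (hh₂ : h ≤ 163 / 200) :
    0 < a ∧ 0 < h ∧ a ^ 2 < 4 * h ^ 2 ∧ a ^ 2 ≤ (6 / 5) ^ 2 ∧ a ^ 2 / 3 + h ^ 2 ≤ (6 / 5) ^ 2 := by
  refine ⟨by linarith, by linarith, by nlinarith, by nlinarith, by nlinarith⟩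

/-- `‖x‖ ≤ 6/5` from `‖x‖² ≤ (6/5)²`. [folklore] -/
theorem norm_le_of_sq_le {x : EuclideanSpace ℝ (Fin 3)} (hx : ‖x‖ ^ 2 ≤ (6 / 5) ^ 2) :
    ‖x‖ ≤ 6 / 5 :=
  (pow_le_pow_iff_left₀ (norm_nonneg _) (by norm_num) two_ne_zero).1 hx

/-! ## Antipodes: first-shell sites with an antipodal site are hexagon sites -/

/-- **The antipode lemma.** For `0 < a`, `0 < h`, `a² < 4h²`: a site of squared norm `a²` whose
antipode is again a site is a hexagon site `(0, i, j)` with `i² + ij + j² = 1` (its layer is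
even by `even_of_neg_site_mem`, and a site of an even layer `k ≠ 0` has squared norm
`≥ 4h² > a²`). [folklore] -/
theorem hexagon_of_norm_sq (ha : 0 < a) (hh : 0 < h) (h4 : a ^ 2 < 4 * h ^ 2) {k i j : ℤ}
    (hn : ‖barlowPos a h alternatingHagg k i j‖ ^ 2 = a ^ 2)
    (hneg : -barlowPos a h alternatingHagg k i j ∈ hcpStacking a h) :
    k = 0 ∧ i ^ 2 + i * j + j ^ 2 = 1 := by
  have hk := even_of_neg_site_mem ha.ne' hh.ne' hneg
  have hL := haggLabel_alternating_of_even hk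
  have hn' : a ^ 2 * ((i : ℝ) ^ 2 + i * j + (j : ℝ) ^ 2) + (k : ℝ) ^ 2 * h ^ 2 = a ^ 2 := by
    rw [hcp_norm_sq_eq, hL] at hn
    push_cast at hn
    linear_combination hn
  have ha2 : 0 < a ^ 2 := by positivity
  have hQ : (0 : ℝ) ≤ (i : ℝ) ^ 2 + i * j + (j : ℝ) ^ 2 := by
    nlinarith [sq_nonneg (2 * (i : ℝ) + j), sq_nonneg (j : ℝ)]
  have hk0 : k = 0 := by
    by_contra hk0
    have hk4 : 4 ≤ k ^ 2 := by
      obtain ⟨m, rfl⟩ := hk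
      have hm : m ≠ 0 := by
        rintro rfl
        exact hk0 (by norm_num)
      have h1 : 1 ≤ m ^ 2 := by
        rcases lt_or_gt_of_ne hm with hm' | hm' <;> nlinarith
      nlinarith
    have hk4' : (4 : ℝ) ≤ (k : ℝ) ^ 2 := by exact_mod_cast hk4
    nlinarith [mul_nonneg ha2.le hQ, mul_le_mul_of_nonneg_right hk4' (sq_nonneg h)]
  subst hk0
  have hQ1 : (i : ℝ) ^ 2 + i * j + (j : ℝ) ^ 2 = 1 := by
    push_cast at hn'
    apply mul_left_cancel₀ ha2.ne'
    linear_combination hn'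
  exact ⟨rfl, by exact_mod_cast hQ1⟩

/-! ## Linear isometries mapping the first shell into the net -/

/-- **Hexagon sites go to hexagon sites.** If a linear isometry `g` maps every site of squared
norm `≤ (6/5)²` into the net then, on the box, the image of a hexagon site `(0, i₀, j₀)`
(`i₀² + i₀j₀ + j₀² = 1`) is a hexagon site: it is a site of squared norm `a²` whose antipode
`g (−(0, i₀, j₀)) = g (0, −i₀, −j₀)` is a site. [folklore] -/
theorem map_hexagon (ha : 0 < a) (hh : 0 < h) (h4 : a ^ 2 < 4 * h ^ 2)
    (ha6 : a ^ 2 ≤ (6 / 5) ^ 2)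
    (g : EuclideanSpace ℝ (Fin 3) ≃ₗᵢ[ℝ] EuclideanSpace ℝ (Fin 3))
    (hg : ∀ k i j : ℤ, ‖barlowPos a h alternatingHagg k i j‖ ^ 2 ≤ (6 / 5) ^ 2 →
      g (barlowPos a h alternatingHagg k i j) ∈ hcpStacking a h)
    {i₀ j₀ : ℤ} (hq : i₀ ^ 2 + i₀ * j₀ + j₀ ^ 2 = 1) :
    ∃ i j : ℤ, i ^ 2 + i * j + j ^ 2 = 1 ∧
      g (barlowPos a h alternatingHagg 0 i₀ j₀) = barlowPos a h alternatingHagg 0 i j := by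
  have hn : ∀ i j : ℤ, i ^ 2 + i * j + j ^ 2 = 1 →
      ‖barlowPos a h alternatingHagg 0 i j‖ ^ 2 = a ^ 2 := by
    intro i j hq
    have hq' : (i : ℝ) ^ 2 + i * j + (j : ℝ) ^ 2 = 1 := by exact_mod_cast hq
    rw [hcp_norm_sq_eq, haggLabel_zero]
    push_cast
    linear_combination a ^ 2 * hq'
  obtain ⟨k, i, j, he⟩ := hg 0 i₀ j₀ (by rw [hn i₀ j₀ hq]; exact ha6)
  have hneg : -barlowPos a h alternatingHagg k i j ∈ hcpStacking a h := by
    rw [← he, ← map_neg g, neg_site_zero]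
    exact hg 0 (-i₀) (-j₀) (by rw [hn (-i₀) (-j₀) (by linear_combination hq)]; exact ha6)
  have hnorm : ‖barlowPos a h alternatingHagg k i j‖ ^ 2 = a ^ 2 := by
    rw [← he, LinearIsometryEquiv.norm_map, hn i₀ j₀ hq]
  obtain ⟨rfl, hij⟩ := hexagon_of_norm_sq ha hh h4 hnorm hneg
  exact ⟨i, j, hij, he⟩

/-- **The normalised case.** If a linear isometry `g` fixing `u` maps every site of squared norm
`≤ (6/5)²` into the net then, on the box, `g` preserves the net: `g v` is a hexagon site with
`⟪u, g v⟫ = a²/2`, so `g v = v` (then `g ∈ {1, σ_h}` by `eq_refl_or_mirrorH`) or `g v = u − v`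
(then the site `g (w + h e₃) = (k', i', j')` would have `2i' + j' + L = 1`, `i' − j' = 1`,
`L ∈ {0, 1}`: impossible). [folklore] -/
theorem mem_iff_of_fix_u (ha : 0 < a) (hh : 0 < h) (h4 : a ^ 2 < 4 * h ^ 2)
    (ha6 : a ^ 2 ≤ (6 / 5) ^ 2) (hp6 : a ^ 2 / 3 + h ^ 2 ≤ (6 / 5) ^ 2)
    (g : EuclideanSpace ℝ (Fin 3) ≃ₗᵢ[ℝ] EuclideanSpace ℝ (Fin 3))
    (hg : ∀ k i j : ℤ, ‖barlowPos a h alternatingHagg k i j‖ ^ 2 ≤ (6 / 5) ^ 2 →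
      g (barlowPos a h alternatingHagg k i j) ∈ hcpStacking a h)
    (hgu : g (barlowPos a h alternatingHagg 0 1 0) = barlowPos a h alternatingHagg 0 1 0)
    (x : EuclideanSpace ℝ (Fin 3)) : g x ∈ hcpStacking a h ↔ x ∈ hcpStacking a h := by
  have ha2 : a ^ 2 ≠ 0 := by positivity
  obtain ⟨i, j, hq, hv⟩ := map_hexagon ha hh h4 ha6 g hg (i₀ := 0) (j₀ := 1) (by norm_num)
  -- `⟪u, g v⟫ = a²/2` pins `g v ∈ {v, u − v}`
  have hinner : ⟪barlowPos a h alternatingHagg 0 1 0, g (barlowPos a h alternatingHagg 0 0 1)⟫ =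
      a ^ 2 / 2 := by
    rw [← hgu, g.inner_map_map, inner_u_site, haggLabel_zero]; push_cast; ring
  rw [hv, inner_u_site, haggLabel_zero] at hinner
  push_cast at hinner
  have h2ij : (2 : ℝ) * i + j = 1 := by
    have := mul_left_cancel₀ ha2 (hinner.trans (by ring : a ^ 2 / 2 = a ^ 2 * (1 / 2)))
    linarith
  have h2ij' : 2 * i + j = 1 := by exact_mod_cast h2ij
  have hb := hexagon_indices (show i ^ 2 + i * j + j ^ 2 < 2 by omega)
  have hcases : (i = 0 ∧ j = 1) ∨ (i = 1 ∧ j = -1) := by omega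
  rcases hcases with ⟨rfl, rfl⟩ | ⟨rfl, rfl⟩
  · -- `g v = v`: `g` is the identity or the horizontal mirror
    rcases eq_refl_or_mirrorH ha.ne' hh.ne' g hgu hv with h1 | h1
    · rw [h1]
    · rw [h1]; exact mirrorH_mem_iff hh.ne' x
  · -- `g v = u - v`: the image of the cap site `w + h e₃` cannot be a site
    exfalso
    have hL1 : haggLabel alternatingHagg 1 = 1 := haggLabel_alternating_of_odd odd_one
    have hp : ‖barlowPos a h alternatingHagg 1 0 0‖ ^ 2 = a ^ 2 / 3 + h ^ 2 := by
      rw [hcp_norm_sq_eq, hL1]; push_cast; ring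
    obtain ⟨k', i', j', hp'⟩ := hg 1 0 0 (by rw [hp]; exact hp6)
    have hv' : g (barlowPos a h alternatingHagg 0 0 1) =
        barlowPos a h alternatingHagg 0 1 0 - barlowPos a h alternatingHagg 0 0 1 := by
      rw [hv, site_sub_of_even Even.zero]; norm_num
    have e1 : (2 : ℝ) * i' + j' + haggLabel alternatingHagg k' = 1 := by
      have e : ⟪barlowPos a h alternatingHagg 0 1 0, barlowPos a h alternatingHagg k' i' j'⟫ =
          a ^ 2 / 2 := by
        rw [← hp', ← hgu, g.inner_map_map, inner_u_site, hL1]; push_cast; ring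
      rw [inner_u_site] at e
      have := mul_left_cancel₀ ha2 (e.trans (by ring : a ^ 2 / 2 = a ^ 2 * (1 / 2)))
      linarith
    have e2 : (i' : ℝ) - j' = 1 := by
      have e : ⟪barlowPos a h alternatingHagg 0 1 0 - barlowPos a h alternatingHagg 0 0 1,
          barlowPos a h alternatingHagg k' i' j'⟫ = a ^ 2 / 2 := by
        rw [← hp', ← hv', g.inner_map_map, inner_v_site, hL1]; push_cast; ring
      rw [inner_uv_site] at e
      have := mul_left_cancel₀ ha2
        ((by ring : a ^ 2 * (((i' : ℝ) - j') / 2) = a ^ 2 * (i' - j') / 2).trans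
          (e.trans (by ring : a ^ 2 / 2 = a ^ 2 * (1 / 2))))
      linarith
    rcases haggLabel_alternating_eq_zero_or_one k' with hL | hL <;> rw [hL] at e1 <;>
      push_cast at e1
    · have h3 : (3 : ℝ) * i' = 2 := by linarith
      have h3' : 3 * i' = 2 := by exact_mod_cast h3
      omega
    · have h3 : (3 : ℝ) * i' = 1 := by linarith
      have h3' : 3 * i' = 1 := by exact_mod_cast h3
      omega

/-- **A linear isometry mapping the first shell into the net preserves the net.** If `g` maps
every site of squared norm `≤ (6/5)²` into the net then, on the box, `g x ∈ net ↔ x ∈ net` for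
all `x`: `g u` is a hexagon site (`map_hexagon`), a symmetry `s` of the net maps `u` to it
(`exists_sym_apply_u`), and `s⁻¹ ∘ g` fixes `u` (`mem_iff_of_fix_u`). [folklore] -/
theorem mem_iff_of_maps (ha : 0 < a) (hh : 0 < h) (h4 : a ^ 2 < 4 * h ^ 2)
    (ha6 : a ^ 2 ≤ (6 / 5) ^ 2) (hp6 : a ^ 2 / 3 + h ^ 2 ≤ (6 / 5) ^ 2)
    (g : EuclideanSpace ℝ (Fin 3) ≃ₗᵢ[ℝ] EuclideanSpace ℝ (Fin 3))
    (hg : ∀ k i j : ℤ, ‖barlowPos a h alternatingHagg k i j‖ ^ 2 ≤ (6 / 5) ^ 2 →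
      g (barlowPos a h alternatingHagg k i j) ∈ hcpStacking a h)
    (x : EuclideanSpace ℝ (Fin 3)) : g x ∈ hcpStacking a h ↔ x ∈ hcpStacking a h := by
  obtain ⟨i, j, hq, hu⟩ := map_hexagon ha hh h4 ha6 g hg (i₀ := 1) (j₀ := 0) (by norm_num)
  have hb := hexagon_indices (show i ^ 2 + i * j + j ^ 2 < 2 by omega)
  have h0 : ¬ (i = 0 ∧ j = 0) := by
    rintro ⟨rfl, rfl⟩
    norm_num at hq
  obtain ⟨s, hs, hsu⟩ := exists_sym_apply_u (h := h) ha.ne' hb h0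
  have hs' : ∀ y, s.symm y ∈ hcpStacking a h ↔ y ∈ hcpStacking a h := fun y => by
    rw [← hs (s.symm y), s.apply_symm_apply]
  have hg₁u : (g.trans s.symm) (barlowPos a h alternatingHagg 0 1 0) =
      barlowPos a h alternatingHagg 0 1 0 := by
    rw [LinearIsometryEquiv.trans_apply, hu, ← hsu, s.symm_apply_apply]
  have hg₁ : ∀ k i j : ℤ, ‖barlowPos a h alternatingHagg k i j‖ ^ 2 ≤ (6 / 5) ^ 2 →
      (g.trans s.symm) (barlowPos a h alternatingHagg k i j) ∈ hcpStacking a h := by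
    intro k i j hn
    rw [LinearIsometryEquiv.trans_apply, hs']
    exact hg k i j hn
  have key := mem_iff_of_fix_u ha hh h4 ha6 hp6 (g.trans s.symm) hg₁ hg₁u x
  rwa [LinearIsometryEquiv.trans_apply, hs'] at key

/-! ## The stub -/

/-- **Stub `stub_hcpContinuationUnique` of line `Sketch` (uniqueness of continuation).** On the
box `189/200 ≤ a ≤ 199/200`, `77/100 ≤ h ≤ 163/200`: if `A` maps every site of
`hcpStacking a h` of norm `≤ 6/5` into `B '' hcpStacking a h` (`A, B` linear isometry
equivalences of `ℝ³`), then `A '' hcpStacking a h = B '' hcpStacking a h`.  Apply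
`mem_iff_of_maps` to `g = B⁻¹ ∘ A = A.trans B.symm`. [folklore] -/
theorem stub_hcpContinuationUnique : ∀ a h : ℝ, 189 / 200 ≤ a → a ≤ 199 / 200 → 77 / 100 ≤ h → h ≤ 163 / 200 → ∀ A B : EuclideanSpace ℝ (Fin 3) ≃ₗᵢ[ℝ] EuclideanSpace ℝ (Fin 3), (∀ z ∈ Literature.MathematicalPhysics.StatisticalMechanics.hcpStacking a h, ‖z‖ ≤ 6 / 5 → ∃ z' ∈ Literature.MathematicalPhysics.StatisticalMechanics.hcpStacking a h, A z = B z') → A '' Literature.MathematicalPhysics.StatisticalMechanics.hcpStacking a h = B '' Literature.MathematicalPhysics.StatisticalMechanics.hcpStacking a h := by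
  intro a h ha₁ ha₂ hh₁ hh₂ A B hAB
  obtain ⟨ha, hh, h4, ha6, hp6⟩ := box_facts ha₁ ha₂ hh₁ hh₂
  have hg : ∀ k i j : ℤ, ‖barlowPos a h alternatingHagg k i j‖ ^ 2 ≤ (6 / 5) ^ 2 →
      (A.trans B.symm) (barlowPos a h alternatingHagg k i j) ∈ hcpStacking a h := by
    intro k i j hn
    obtain ⟨z', hz', he⟩ := hAB _ (barlowPos_mem k i j) (norm_le_of_sq_le hn)
    rw [LinearIsometryEquiv.trans_apply, he, LinearIsometryEquiv.symm_apply_apply]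
    exact hz'
  have key := mem_iff_of_maps ha hh h4 ha6 hp6 (A.trans B.symm) hg
  ext x
  simp only [Set.mem_image]
  constructor
  · rintro ⟨y, hy, rfl⟩
    refine ⟨B.symm (A y), ?_, B.apply_symm_apply _⟩
    have := (key y).2 hy
    rwa [LinearIsometryEquiv.trans_apply] at this
  · rintro ⟨y, hy, rfl⟩
    refine ⟨A.symm (B y), ?_, A.apply_symm_apply _⟩
    have := (key (A.symm (B y))).1
    rw [LinearIsometryEquiv.trans_apply, A.apply_symm_apply, B.symm_apply_apply] at this
    exact this hy

end Summit.AtomisticToContinuum.Crystallization.Theorems.PricedHcpWindowsHcpContinuation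

end
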